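import Literature.NumberTheory.EllipticCurves.Kriz2020.CongruentNumberDensityOneProofs
import Literature.NumberTheory.EllipticCurves.BurungaleKobayashiOta2024.SupersingularPConverse
import Literature.NumberTheory.EllipticCurves.BurungaleKobayashiNakamuraOta2026.AnticyclotomicStrictSelmerTorsionOPEN
import HarnessLib

/-!
# Fan–Wan (arXiv:2304.09806v2): the rank-one `p`-converse for self-dual CM Hecke characters at ALL primes — Thm. 1.1 [ThmM] and Thm. 6.9 [main proposition] typed as OPEN CLAIMS, with the §§4–6 architecture recorded by locator

HONEST FRAMING (cell `bsd-cn100`, `run/shared/lean/pub/bsd-cn100/`, seat `bsd-cn100-ty`, D-0074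
row «Burungale–Kobayashi–Ota 2024 Thm 1.5 + Fan–Wan v2 §5/Thm 6.9 statements-first with locators,
the cite-only inputs of the routes `CongruentShaFreeCut` (rung S2) and `MordellShaFreeCut` (rung
S2b)»). Burungale–Kobayashi–Ota 2024 Thm. 1.5 (REFEREED) is the tree's named fact
`BurungaleKobayashiOta2024.thm15_analyticRank_eq_one_of_selmerCorank_eq_one` and is NOT retyped.
This file types the SECOND cite-only input: the CLAIMED theorems of the UNREFEREED preprint of Fan
and Wan, in the only vocabulary the tree has for them — a CM elliptic curve over `ℚ` standing in for
its Hecke character (the authors' own reading of their Thm. 1.1 in the proofs of Thm. 1.2 and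
Thm. 1.4, see the dictionary) — as `def …_CLAIMED : Prop` (nothing is asserted, D-0014; template
`BurungaleKobayashiNakamuraOta2026.prop37_isTorsion_strictAcSelmerDual_OPEN`), plus 0-sorry
bookkeeping theorems placing the claims against the tree: the claim CONTAINS Kříž's claim
(`kriz_analyticRank_eq_one_of_selmerCorank_eq_one_of_cmRamified`) and hence both rung leaves
(`rankOne_twoConverse_congruentNumber`, `rankOne_threeConverse_mordellCurve`); in the good ordinary
regime `p ≥ 5` it is Burungale–Tian's THEOREM (tree fact
`burungaleTian_analyticRank_eq_one_of_selmerCorank_eq_one_of_hasCM`). NEVER cite the `_CLAIMED`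
`Prop`s as theorems; every consumer takes them as explicit hypotheses. BSD is not proved by any of
this; a closed consumer closes a rung leaf, never the summit.

## Citation header

* Yangyu Fan, Xin Wan, *`p`-adic Waldspurger Formula for Non-split Primes and Converse of
  Gross–Zagier and Kolyvagin Theorem*, arXiv:2304.09806 [math.NT]; v1 (2023), **v2 (2026)**. Bib
  key `FanWan2023`. READ by this seat from the v2 e-print SOURCE held by the cell,
  `HOME/fanwan-v2/FanWan_v2.tex` (3073 lines, sha256 `57b5be2e413b5f61970bf15d5243c12807ab1960fca76ed8b831c05bc5359c58`);
  every locator `l.N` below is a line of that file, and the theorem numbers are computed from the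
  source (`\newtheorem{thm}{Theorem}[section]`, one counter shared by all environments; §5 =
  `\section{Local aspect of the ± -Iwasawa theory}` l.1702, §6 = `\section{Perrin-Riou's main
  conjecture and p-converse}` l.2074, §7 = Split Case l.2394, App. A l.2434, App. B l.2523).
* STATUS (2026-08-26): PREPRINT, NOT REFEREED (no journal, no DOI beyond arXiv). The cell's two
  independent adversarial reads of v2 (`HOME/GAP-LEDGER-read1-fanwan-v2.md`: §§2–4 + App. A–B;
  `HOME/GAP-LEDGER-read2-fanwan-v2.md`: §§5–7) record, on the load path of the `p = 2` ramified
  application: read1-fw-1 **GAP** (Prop. 3.10 `\ref{Int}`, l.1515: the interpolation formula of the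
  anticyclotomic `p`-adic `L`-function is "adapting [AI, Prop. 5.6 & 6.4]", unwritten at `p = 2`
  ramified / quaternionic / translated CM points), read1-fw-2 FIXABLE (App. A test vector: all
  `ℓ ≫ 2n` outside one congruence class), read1-fw-3 **GAP** (App. B Rem. `\ref{constantC}`:
  `C ≠ 0` computed only for split `p`), read1-fw-4/5/6 CITE (§4 syntomic inputs [ABSV] printed for
  odd `p`; §2 rests on the unrefereed thesis [Fan]; [AI] lemmas printed for odd `p`); read2-fw-1
  **GAP** for Thm. 1.1 as stated (no sign hypothesis, §6 proves only root number `−1`; FIXABLE for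
  elliptic curves over `ℚ` by `p`-parity), read2-fw-2 **GAP** (no exceptional-zero check at `φ₀`),
  read2-fw-3 FIXABLE, read2-fw-4 CITE ([BSW], [CW], [Jia], [Venjakob], [Smith1]), read2-fw-5 ….
  Adjudication: `HOME/VERDICT.md`. Expert print 2022–2026 states the ramified rank-one `2`- or
  `3`-converse as OPEN (Tian, Proc. ICM 2022; Burungale–Tian, Ann. of Math. 203 (2026), p. 2); no paper
  cites Fan–Wan's Thm. 1.1 as a theorem (cell memo `LIT-STATUS-MEMO.md` §A, `LIT-G14` E2).

## The printed statements (verbatim from the source)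

* Abstract (l.465): "… a new kind of anticyclotomic local `±`-Iwasawa theory at `p` for self-dual
  Hecke characters over imaginary quadratic fields (including elliptic curves `E/ℚ` with complex
  multiplication) which is valid for all ramification types of `p` (split, inert and ramified, and
  allowing `p = 2`). As the main consequence, we prove the converse of the Gross–Zagier–Kolyvagin
  theorem for self-dual CM characters: if the Selmer rank of `ψ` is `1`, then the analytic rank of
  `L(ψ,s)` at `s = 1` is also `1`."
* **Theorem 1.1** (`\label{ThmM}`, l.512–515): "Let `ψ` be a Hecke character of `𝒦` with
  Archimedean type `(−1,0)` whose restriction to `𝔸_ℚ^×` is `|·|^{−1}χ_𝒦` where `χ_𝒦` is the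
  quadratic character corresponding to `𝒦/ℚ`. If the rank of the Selmer group for `ψ` is `1`, then
  the vanishing order of `L(ψ,s)` at `s = 1` is also `1`."
* Theorem 1.2 (l.518): every prime `p ≡ 4, 7, 8 (mod 9)` is a sum of two rational cubes — proof
  (l.523): "`E_p : x³ + y³ = p` … has complex multiplication by `ℚ(√−3)` … root number `−1` … by
  [Sta, Thm. 2.9] the `3`-adic Selmer rank of `E_p` is `≤ 2` … by [DD, Thm. 1.9] odd. Thus it must
  be `1`. By Theorem 1.1, the `L`-function of `E_p` has order `1`." Theorem 1.4 (l.531, conditional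
  on [Smith1, Thm. 1.1]): Goldfeld for CM elliptic curves over `ℚ` — proof (l.535): "`50` percent
  have `2`-adic Selmer ranks `1`. Now by Theorem 1.1 (for rank `1`) … for `p = 2`".
* §5 standing hypothesis (l.1703): "From now on, we assume `p` is non-split in `𝒦` except in
  Section 7." §5.2 (l.1737): "`ψ₀` … is called self-dual if it has Archimedean type `(−n−1, n)` …
  and its restriction to `𝔸_ℚ^×` is `χ_𝒦|·|^{−1}`." §5.4 (l.1795): "We take an elliptic curve `E`
  with CM by `𝒪_𝒦`. Let `ψ_E` be the associated Hecke character, which has infinity type `(−1,0)`."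
* §6 standing hypothesis (l.2075): "Let `ψ` be a self-dual Hecke character of Archimedean type
  `(−1,0)` such that the global root number is `−1`." Coefficients (l.2076): `Λ^{−,′} = 𝒪_L⟦p^{−m}X⟧`,
  `Λ^{−,′}_L = Λ^{−,′} ⊗ L`, `m ≫ 0` (a shrunk disc of the anticyclotomic weight space).
* **Theorem 6.9** (`\label{main proposition}`, l.2204–2206): "If the Selmer rank of `ψ` is `1`,
  then the specialization `κ_{f,χ}` of the virtual Heegner family to `φ₀` is non-torsion, and thus
  the vanishing order of `L(ψ, s)` at `s = 1` is exactly `1`." Proof (l.2207–2226): the length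
  identity (PRCJ) `2·leng_P(H¹_+(𝒦^S,𝛙)/Λ^{−,′}_L κ^{virt}) = leng_P(X^+_{ψ,tor}) + ord_P(𝓛^∘_{ξχ^c})
  = leng_P(X^+_{ψ,tor})` at `P = (X)` from (vhf), (imc) = Cor. 6.4 and (exactsequence); "under the
  assumption that the Selmer rank of `ψ` is `1`, we see that `X` does not divide
  `char(X^+_{ψ,tor})`. Thus the specialization … must be non-torsion. … together with the
  Gross–Zagier and Kolyvagin theorem imply the last sentence".

## Transcription dictionary (word for word → tree vocabulary), and why it is the authors' reading

1. "`ψ` self-dual of type `(−1,0)`, `ψ|_{𝔸_ℚ^×} = |·|^{−1}χ_𝒦`" ⟶ `ψ = ψ_E` for `W : WeierstrassCurve ℚ`,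
   `[W.IsElliptic]`, `W.j ∈ maximalCMJInvariants` (CM by the MAXIMAL order `𝒪_𝒦`, §5.4 l.1795;
   `ComplexMultiplication.lean`, Silverman *Advanced Topics* App. A §3), so that `L(ψ_E, s) = L(E/ℚ, s)`
   (Deuring). The general `GL₂`-type `ψ` is NOT typed. -- TODO(general form): self-dual CM Hecke
   characters of an imaginary quadratic field (no `HeckeCharacter`-level Selmer group in the tree).
2. "the Selmer rank of `ψ` is `1`" (the Bloch–Kato Selmer group `H¹_f(𝒦, L(ψ))`, §5.1 l.1707–1731,
   an `L`-vector space, `L ⊇ 𝒦_𝔭`) ⟶ `W.selmerCorank p = 1` (`corank_{ℤ_p} Sel_{p^∞}(E/ℚ)`,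
   `Selmer.lean`). This is the AUTHORS' reading: proof of Thm. 1.2 (l.523, "the `3`-adic Selmer rank
   of `E_p` … By Theorem 1.1") and proof of Thm. 1.4 (l.535, "`2`-adic Selmer ranks `1` … by
   Theorem 1.1"). (Bookkeeping: `dim_{𝒦_𝔭} H¹_f(𝒦, V_𝔭E) = ½ corank_{ℤ_p} Sel_{p^∞}(E/𝒦) =
   corank_{ℤ_p} Sel_{p^∞}(E/ℚ)`, the quadratic twist `E^{(𝒦)}` being `ℚ`-isogenous to `E`.)
3. "the vanishing order of `L(ψ,s)` at `s = 1` is `1`" ⟶ `W.analyticRank = 1`.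
4. "`p` non-split in `𝒦`" (§5, l.1703) ⟶ `¬ Rank1Residual.CMSplit W p` (`Rank1Residual/Predicates.lean`:
   `p` ramified, `p ∣ d_K`, or inert); "global root number `−1`" (§6, l.2075) ⟶ `W.rootNumber = -1`
   (`RootNumber.lean`; `w(E/ℚ) = w(ψ_E)`).
5. The prime `p` is arbitrary (abstract l.465: "allowing `p = 2`"); `L`, `𝔭`, `m` leave no trace.

## The §§4–6 architecture, by locator — NOT TYPED (objects absent from the tree and Mathlib)

The claims below are the internal steps of the printed proof of Thm. 6.9. Their objects — Iwasawa
cohomology `H¹(𝒦^S, 𝛙)`, `H¹(𝒦_p, 𝛙)` of the anticyclotomic family `𝛙 = ψΨ^−_𝒦` over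
`Λ^−_L = 𝒪_L⟦Γ^−_𝒦⟧ ⊗ L` / `Λ^{−,′}_L`, Kato's elliptic-unit classes `z_{p^∞,ψ}` (§5.4, Def. l.1841),
the `±`-submodules `H¹_±(𝒦_p, 𝛙)` (Def. 5.24), the anticyclotomic `p`-adic `L`-functions `𝓛^∘_ψ`,
`𝓛^•_ψ`, `𝓛_{f,χ}` (Def. 5.20 `\ref{pLf}` l.1957, built in §3 by `p`-adic iteration of the
Gauss–Manin connection on quaternionic Shimura curves), generalized Heegner classes `z^{φ,χ}` /
`κ_{f,χ}` (§4.2, App. B) and the virtual Heegner family (Def. 6.8) — have no counterpart in the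
tree (`lean search 'anticyclotomic|signedSelmer|ellipticUnit'`: the tree's anticyclotomic objects
are Castella's split-prime `AcSelmer.XAc` / `IsBDPLFunction` and compact Selmer data, none of which
is Fan–Wan's). They are recorded here so that a consumer can name exactly which step it posits;
a posited-interface typing is deferred until a consumer names the leaves it needs (D-0026: no junk
facts). Locators (all CLAIMED, status as above):
* Thm. 4.2 [ERC1] (l.1623) / Thm. 4.4 [ERC2] (l.1629): `p`-adic Waldspurger formula / explicit
  reciprocity law `𝒫_φ(χ)/Ω_p^{r−2j} = ⟨log_p z^{φ,χ}, ω_{π,χ}⟩` for `χ` algebraic of infinity type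
  `(1+j, r+1−j)` (outside the interpolation range); proof via the syntomic formalism of [ABSV]
  (footnote l.1632: "`p = 2` is not excluded as explained by authors in a private communication").
* Lemma 5.12 [freeness] (l.1848), Prop. 5.13 [nontriviality] (l.1856: `z_{p^∞,ψ₀} ≠ 0` in
  `H¹(𝒦^S, 𝛙₀)`), Def. 5.14 (strict/relaxed Selmer, l.1867), Lemma 5.15 [strictcontrol] (l.1878),
  Lemma 5.16 [global] (l.1899: `X^{str}_{ψ₀}` is `Λ^−_L`-torsion — its first clause IS typed below,
  on Castella's module, see `lem516_…_CLAIMED` — and `H¹_{str}` has rank `0`), Cor. 5.17 (l.1905: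
  `H¹(𝒦^S, 𝛙₀)` has `Λ^−_L`-rank one).
* **Thm. 5.18 [RMCC]** (l.1917–1921): "`char_{Λ^−_L}(X^{str}_{ψ₀}) = char_{Λ^−_L}(H¹_{Iw}(𝒦^−_∞, 𝛙₀)/Λ^−_L z_{p^∞,ψ₀})`"
  (Rubin's two-variable main conjecture [JK, Thm. 5.2] restricted to the anticyclotomic line with
  `p` inverted); Cor. 5.19 [1111] (l.1938): `ord_{s=1} L(ψ₀,s) = 1 ⟹ φ₀(z_{p^∞,ψ₀})` has nonzero
  restriction to `H¹_f(𝒦_p, ψ₀)` (uses Lemma 5.23 [AV] = [BSW, Thm. 2.8], unrefereed).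
* Def. 5.24 [mainlocaltheory] (l.1986): `H¹_∓(𝒦_p, 𝛙)` := the `Λ^{−,′}_L`-span of `z_{p^∞,ψχ′}`,
  `z_{p^∞,ψχ″}` for auxiliary anticyclotomic `χ′, χ″` (Lemma 5.21, from [Jia] / Rohrlich); Prop. 5.25
  (RMC) (l.1993): `H¹(𝒦_p,𝛙) = H¹_+ ⊕ H¹_−` after enlarging `m` ("second theory", l.2014 ff.,
  assumes `p ≠ 2`; only the first theory is on the `p = 2` path).
* Cor. 6.4 [AIMC] (l.2112): `char_{Λ^{−,′}_L}(X^−_ψ) = (𝓛^•_ψ)` after shrinking the weight space;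
  (exactsequence) l.2186: `leng_P X^+_{ψ,tor} + 2·locind_P = leng_P X^−_ψ`; Def. 6.8 (l.2192, virtual
  Heegner family, (vhf)); **Thm. 6.9** (l.2204); Prop. 6.12 [isvirtualHeegner] (l.2243: the
  specialization of `κ_{𝓕,𝛘}` to `f` is a virtual Heegner family); §7 (l.2394–2418): split `p`,
  big regulator maps of [LZ1, Thm. 4.15] (`p > 2`) and [Venjakob] (`p = 2`).

## What is typed, and what the bookkeeping theorems say

* `thmM_analyticRank_eq_one_of_selmerCorank_eq_one_CLAIMED` — Thm. 1.1 for CM-by-`𝒪_K` curves over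
  `ℚ`, every prime `p`. `thm69_analyticRank_eq_one_of_selmerCorank_eq_one_of_not_cmSplit_CLAIMED` —
  Thm. 6.9 (its "and thus" clause) under the §§5–6 standing hypotheses (`p` non-split, root number
  `−1`); its first clause (non-torsion of `κ_{f,χ}`) is untyped (object absent).
  `lem516_isTorsion_strictAcSelmerDual_CLAIMED` — Lemma 5.16 [global], first clause ("`X^{str}_{ψ₀}`
  is torsion over `Λ^−_L`"), the one §5 statement with an object in the tree: Castella's strict
  anticyclotomic Selmer dual `AcSelmer.XAc (W.baseChange K) p κ 𝔭 ∅ γ` (the SAME module and binder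
  list as the typed BKNO 2026 claim `prop37_isTorsion_strictAcSelmerDual_OPEN`, which is `p ≥ 5`
  RAMIFIED; Fan–Wan claim it at EVERY non-split `p`, `p = 2, 3` included). Dictionary: FW's
  `Sel^{str}(𝒦^S, 𝛙₀^*)` (Def. 5.14, l.1867: unramified outside `S`, trivial at every `v ∈ S`,
  `v ∣ p` included; Shapiro: a Selmer group over `𝒦^−_∞`) with `(L/𝒪_L)(ψ_E) ≅ E[p^∞] ⊗_{𝒪_𝔭} 𝒪_L`
  DOMINATES Castella's `Sel_𝔭(K_∞, E[p^∞])` (Castella 2018 Def. 2.2: strict at the unique `𝔭 ∣ p`,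
  the usual FINITE-INDEX — not trivial — local conditions at `w ∤ p`): the two Selmer groups differ at
  the finitely many `w ∤ p` by local terms that are `p`-power torsion of bounded exponent (the source's
  own comparison, proof of Thm. 5.18, l.1925–1934), so `Λ^−_L`-torsion of FW's `X^{str}` (= element-wise
  `Λ`-torsion of its integral form, `p` being invertible only in the coefficients) gives `Λ`-torsion
  of Castella's dual by the standard cotorsion/finite-index argument (Greenberg) — WEAKER-OR-EQUAL to
  print. (Gloss corrected after referee read2 g34, finding read2-h34-2; locator l.1703 per read2-h34-1.)
* `thm69_CLAIMED_of_thmM_CLAIMED` (6.9 is a slice of 1.1); `analyticRank_eq_one_of_hasCM_of_thmM_CLAIMED`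
  (CM by any order, by the `ℚ`-isogeny to a maximal-order curve — tree theorems);
  `kriz_cmRamified_of_thmM_CLAIMED`, `rankOne_twoConverse_congruentNumber_of_thmM_CLAIMED`,
  `rankOne_threeConverse_mordellCurve_of_thmM_CLAIMED` (the claim contains Kříž's claim and both
  rung leaves); the same three from Thm. 6.9 granted the `p`-parity theorem (`p_parity`,
  Dokchitser–Dokchitser 2010, tree fact): `…_of_thm69_CLAIMED_of_parity`. Placement: in the good ordinary regime `p ≥ 5` the claim is
  Burungale–Tian's refereed Thm. 1.2 (tree theorem `maximalOrder_form_of_burungaleTian`, not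
  restated); the inert good regime `p ≥ 5` WITH `Ш[p^∞]` finite is Burungale–Kobayashi–Ota 2024
  Thm. 1.5 (`thm69_conclusion_goodSupersingular_of_bko`, the sentence of l.496).

## References

* [FanWan2023] Y. Fan, X. Wan, arXiv:2304.09806v2: Thm. 1.1 (l.512), Thm. 1.2 (l.518), Thm. 1.4
  (l.531), §5 (l.1702–2073: Thm. 5.18 l.1917, Cor. 5.19 l.1938, Def. 5.24 l.1986), §6 (l.2074–2393:
  Cor. 6.4 l.2112, Def. 6.8 l.2192, Thm. 6.9 l.2204, Prop. 6.12 l.2243), §7 (l.2394).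
* [Kriz2020] D. Kříž, arXiv:2002.04767v5, Thm. 10.13 (the other claimed proof at ramified `p`).
* [BurungaleKobayashiOta2023] JIMJ 23 (2024), Thm. 1.5 (p. 1422) (inert `p ≥ 5`, refereed).
* [BurungaleTian2019] Invent. Math. 220 (2020), Thm. 1.2 (p. 214) (good ordinary `p ≥ 5`, refereed).
* [DokchitserDokchitserAnnals2010] Ann. of Math. 172 (2010), Thm. 1.4 (`p`-parity over `ℚ`, all `p`).
* [Darmon2004] CBMS 101, Thm. 3.22 (Gross–Zagier–Kolyvagin).
* [Castella2018] Camb. J. Math. 6 (2018), Def. 2.2 (the module `X_ac`); [BurungaleKobayashiNakamuraOta2026]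
  arXiv:2608.06879v1, Prop. 3.7 (2) (the typed ramified `p ≥ 5` twin of Lemma 5.16).
-/

noncomputable section

open scoped Classical

open WeierstrassCurve NumberField IsDedekindDomain Field Literature.NumberTheory.EllipticCurves
  Literature.NumberTheory.EllipticCurves.Rank1Residual Literature.NumberTheory.EllipticCurves.Castella2018

namespace Literature.NumberTheory.EllipticCurves.FanWan2023

/-! ### The two claimed statements -/

/-- **OPEN CLAIM — UNREFEREED PREPRINT. Fan–Wan, arXiv:2304.09806v2, Theorem 1.1 (`\label{ThmM}`,
FanWan_v2.tex l.512–515)**, verbatim: "Let `ψ` be a Hecke character of `𝒦` with Archimedean type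
`(−1,0)` whose restriction to `𝔸_ℚ^×` is `|·|^{−1}χ_𝒦` … If the rank of the Selmer group for `ψ`
is `1`, then the vanishing order of `L(ψ,s)` at `s = 1` is also `1`." Transcribed in the SPECIAL
CASE `ψ = ψ_E`, `E/ℚ` with CM by the maximal order `𝒪_𝒦` (`W.j ∈ maximalCMJInvariants`), at an
ARBITRARY prime `p` (abstract, l.465: "split, inert and ramified, and allowing `p = 2`"):
`corank_{ℤ_p} Sel_{p^∞}(E/ℚ) = 1 ⟹ ord_{s=1} L(E/ℚ, s) = 1` — the authors' own reading of the
hypothesis for CM elliptic curves (proofs of Thm. 1.2, l.523, and Thm. 1.4, l.535). Cell verdict on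
the printed proof: read2-fw-1 GAP for the statement as printed (§6 proves only root number `−1`;
for `E/ℚ` repaired by `p`-parity), read1-fw-1 / read1-fw-3 / read2-fw-2 GAP, others FIXABLE/CITE
(module docstring). The form for CM by an arbitrary order is the THEOREM
`analyticRank_eq_one_of_hasCM_of_thmM_CLAIMED`. NEVER cite this `Prop` as a theorem; take it as an
explicit hypothesis. [claim: FanWan2023, status: under-review] -/
def thmM_analyticRank_eq_one_of_selmerCorank_eq_one_CLAIMED : Prop :=
  ∀ (W : WeierstrassCurve ℚ) [W.IsElliptic] (_hj : W.j ∈ maximalCMJInvariants) (p : ℕ)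
    [Fact p.Prime] (_h : W.selmerCorank p = 1), W.analyticRank = 1

/-- **OPEN CLAIM — UNREFEREED PREPRINT. Fan–Wan, arXiv:2304.09806v2, Theorem 6.9
(`\label{main proposition}`, FanWan_v2.tex l.2204–2206)**, verbatim: "If the Selmer rank of `ψ` is
`1`, then the specialization `κ_{f,χ}` of the virtual Heegner family to `φ₀` is non-torsion, and
thus the vanishing order of `L(ψ, s)` at `s = 1` is exactly `1`", under the standing hypotheses of
§5 (l.1703: "`p` is non-split in `𝒦`") and §6 (l.2075: "`ψ` … self-dual … of Archimedean type
`(−1,0)` such that the global root number is `−1`"). Transcribed in the special case `ψ = ψ_E`,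
`E/ℚ` with CM by `𝒪_𝒦` (`W.j ∈ maximalCMJInvariants`): `p` not split in the CM field
(`¬ CMSplit W p`: ramified or inert), `w(E/ℚ) = −1` (`W.rootNumber = -1`),
`corank_{ℤ_p} Sel_{p^∞}(E/ℚ) = 1 ⟹ ord_{s=1} L(E/ℚ, s) = 1` — ONLY the "and thus" clause; the
first clause (non-torsion of the generalized Heegner class `κ_{f,χ}` of the pair `(f_ξ, χ/𝒦)`,
App. B) has no object in the tree and is not typed. Printed proof: Thm. 5.18 [RMCC] + Cor. 6.4
[AIMC] + the `p`-adic Waldspurger formulae Thm. 4.2/4.4 + the virtual Heegner family Def. 6.8 /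
Prop. 6.12, assembled in the length identity (PRCJ), then Gross–Zagier–Kolyvagin (module docstring,
with the cell's verdict codes read2-fw-2 GAP, read2-fw-5, read1-fw-1 and read1-fw-3 GAP upstream). NEVER cite
this `Prop` as a theorem. [claim: FanWan2023, status: under-review] -/
def thm69_analyticRank_eq_one_of_selmerCorank_eq_one_of_not_cmSplit_CLAIMED : Prop :=
  ∀ (W : WeierstrassCurve ℚ) [W.IsElliptic] (_hj : W.j ∈ maximalCMJInvariants) (p : ℕ)
    [Fact p.Prime] (_hns : ¬ CMSplit W p) (_hw : W.rootNumber = -1) (_h : W.selmerCorank p = 1),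
    W.analyticRank = 1

/-- **OPEN CLAIM — UNREFEREED PREPRINT. Fan–Wan, arXiv:2304.09806v2, Lemma 5.16
(`\label{global}`, FanWan_v2.tex l.1899–1900), first clause**, verbatim: "The module `X^{str}_{ψ₀}`
is torsion over `Λ^−_L`", where (§5.5, l.1864–1877) `ψ₀` is a self-dual character of Archimedean type
`(−1,0)`, `Λ^−_L = 𝒪_L⟦Γ^−_𝒦⟧ ⊗ L` is the anticyclotomic Iwasawa algebra with `p` inverted,
`𝛙₀ = ψ₀Ψ^−_𝒦`, and `X^{str}_{ψ₀} = Sel^{str}(𝒦^S, 𝛙₀^*)^*` is the Pontryagin dual of the strict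
Selmer group (Def. 5.14, l.1867: classes unramified outside `S` and trivial at every `v ∈ S`, `v ∣ p`
included), `p` non-split in `𝒦` (§5, l.1703); printed proof (l.1901–1903): "the generic
non-triviality of the elliptic unit Euler system over `Λ^−`, Proposition 5.13, and the standard Euler
system argument (e.g., [Rubin3, Section 2.2])". Transcribed in the SPECIAL CASE `ψ₀ = ψ_E`, `E/ℚ`
with CM by `𝒪_𝒦` (`W.j ∈ maximalCMJInvariants`), `p` ANY prime not split in the CM field
(`¬ CMSplit W p`), `K` the CM field (`IsImaginaryQuadratic K`, `discr K = d_K`), `𝔭` the prime of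
`K` above `p`, `κ` the anticyclotomic `ℤ_p`-extension with topological generator `γ`, on Castella's
module `AcSelmer.XAc (W.baseChange K) p κ 𝔭 ∅ γ` — the strict-at-`𝔭` anticyclotomic Selmer dual of
`E[p^∞]`, a QUOTIENT of the integral form of FW's `X^{str}` (module docstring), so this `Prop` is
weaker-or-equal to the printed clause. Same module and binders as the typed BKNO 2026 claim
`BurungaleKobayashiNakamuraOta2026.prop37_isTorsion_strictAcSelmerDual_OPEN` (`p ≥ 5` ramified,
`W.HasCM`); Fan–Wan's claim covers every non-split `p`, in particular `p = 2` for `ℚ(i)` and `p = 3`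
for `ℚ(√−3)`. Cell verdict on §5: read2 "line-by-line … no false statement found", read2-fw-7 CITE
(Kato's explicit reciprocity law for elliptic units at `p = 2`). NEVER cite this `Prop` as a
theorem. [claim: FanWan2023, status: under-review]
[cite: Castella2018, Def. 2.2 (arXiv:1704.06608 p. 5) (the module; shape only)] -/
def lem516_isTorsion_strictAcSelmerDual_CLAIMED : Prop :=
  ∀ (W : WeierstrassCurve ℚ) [W.IsElliptic] (p : ℕ) [Fact p.Prime]
    (K : Type) [Field K] [NumberField K] (𝔭 : HeightOneSpectrum (𝓞 K))
    (κ : ZpExtension K p) (γ : absoluteGaloisGroup K) [Fact (κ.IsTopGenerator γ)],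
    W.j ∈ maximalCMJInvariants → ¬ CMSplit W p → IsImaginaryQuadratic K →
    NumberField.discr K = cmFieldDiscrOfJ W.j → ((p : ℕ) : 𝓞 K) ∈ 𝔭.asIdeal → κ.IsAnticyclotomic →
      Module.IsTorsion (IwasawaAlgebra p) (AcSelmer.XAc (W.baseChange K) p κ 𝔭 ∅ γ)

/-! ### Bookkeeping: Thm. 6.9 is a slice of Thm. 1.1; CM by any order -/

/-- Thm. 6.9 (non-split `p`, root number `−1`) is the corresponding slice of Thm. 1.1 (every `p`,
no sign hypothesis): pure logic. [claim: FanWan2023, status: under-review] -/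
theorem thm69_CLAIMED_of_thmM_CLAIMED
    (h : thmM_analyticRank_eq_one_of_selmerCorank_eq_one_CLAIMED) :
    thm69_analyticRank_eq_one_of_selmerCorank_eq_one_of_not_cmSplit_CLAIMED :=
  fun W _ hj p _ _ _ h1 ↦ h W hj p h1

/-- **Thm. 1.1 for every CM elliptic curve over `ℚ`** (CM by an arbitrary order, the tree's
`W.HasCM`; abstract l.465 "including elliptic curves `E/ℚ` with complex multiplication"), from the
maximal-order form: a CM curve `E/ℚ` is `ℚ`-isogenous to `E'` with `j(E') ∈ maximalCMJInvariants`
(Silverman, *Advanced Topics*, II Ex. 2.12(b), tree theorem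
`exists_isIsogenous_j_mem_maximalCMJInvariants_of_hasCM_holds`), and the `p^∞`-Selmer corank
(`IsIsogenous.selmerCorank_eq`) and `ord_{s=1} L` (`analyticRank_eq_of_isIsogenous'`, Knapp
Thm. 11.67) are isogeny invariants. [claim: FanWan2023, status: under-review]
[cite: SilvermanAdvancedTopics1994, Ch. II Exercise 2.12(b) (p. 175) and App. A §3 (p. 483)] -/
theorem analyticRank_eq_one_of_hasCM_of_thmM_CLAIMED
    (h : thmM_analyticRank_eq_one_of_selmerCorank_eq_one_CLAIMED)
    (W : WeierstrassCurve ℚ) [W.IsElliptic] (hCM : W.HasCM) (p : ℕ) [Fact p.Prime]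
    (h1 : W.selmerCorank p = 1) : W.analyticRank = 1 := by
  obtain ⟨W', _, hiso, hj⟩ := exists_isIsogenous_j_mem_maximalCMJInvariants_of_hasCM_holds W hCM
  have h1' : W'.selmerCorank p = 1 := by rw [← hiso.selmerCorank_eq p, h1]
  rw [analyticRank_eq_of_isIsogenous' hiso]
  exact h W' hj p h1'

/-- **Bookkeeping, converse direction**: the `HasCM` form contains the printed maximal-order form
(`hasCM_of_j_mem_maximalCMJInvariants_holds`, Silverman *AEC* C.11.3.1), so Thm. 1.1 for curves is
EQUIVALENT to its `HasCM` form. [claim: FanWan2023, status: under-review]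
[cite: SilvermanAdvancedTopics1994, App. A §3 (p. 483)] -/
theorem thmM_CLAIMED_iff_hasCM_form :
    thmM_analyticRank_eq_one_of_selmerCorank_eq_one_CLAIMED ↔
      ∀ (W : WeierstrassCurve ℚ) [W.IsElliptic], W.HasCM →
        ∀ (p : ℕ) [Fact p.Prime], W.selmerCorank p = 1 → W.analyticRank = 1 :=
  ⟨fun h W _ hCM p _ h1 ↦ analyticRank_eq_one_of_hasCM_of_thmM_CLAIMED h W hCM p h1,
    fun h W _ hj p _ h1 ↦ h W (hasCM_of_j_mem_maximalCMJInvariants_holds W hj) p h1⟩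

/-! ### Bookkeeping: the claim contains Kříž's claim and both rung leaves -/

/-- Fan–Wan's Thm. 1.1 (every `p`) contains Kříž's claimed Thm. 10.13 (`p` ramified in the CM
field), as typed in `Kriz2020/RankOnePConverse.lean`: pure logic (drop the ramification
hypothesis). Two unrefereed claims of the same statement by different methods; neither is a
theorem of the tree. [claim: FanWan2023, status: under-review] -/
theorem kriz_cmRamified_of_thmM_CLAIMED
    (h : thmM_analyticRank_eq_one_of_selmerCorank_eq_one_CLAIMED) :
    kriz_analyticRank_eq_one_of_selmerCorank_eq_one_of_cmRamified :=
  fun W _ hj p _ _ h1 ↦ h W hj p h1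

/-- **The rung-S2 leaf from Fan–Wan's claim**: Thm. 1.1 at `p = 2` for `E_n : y² = x³ − n²x`
(`j = 1728`, CM by `ℤ[i]`, `2` ramified in `ℚ(i)`) is `rankOne_twoConverse_congruentNumber` — the
statement the proof of Thm. 1.4 (l.535) applies to the congruent number family. Via
`kriz_cmRamified_of_thmM_CLAIMED` and the tree theorem `rankOne_twoConverse_congruentNumber_of_cmRamified`.
[claim: FanWan2023, status: under-review] -/
theorem rankOne_twoConverse_congruentNumber_of_thmM_CLAIMED
    (h : thmM_analyticRank_eq_one_of_selmerCorank_eq_one_CLAIMED) :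
    rankOne_twoConverse_congruentNumber :=
  rankOne_twoConverse_congruentNumber_of_cmRamified (kriz_cmRamified_of_thmM_CLAIMED h)

/-- **The rung-S2b leaf from Fan–Wan's claim**: Thm. 1.1 at `p = 3` for `y² = x³ + D` (`j = 0`, CM
by `ℤ[(1+√−3)/2]`, `3` ramified) is `rankOne_threeConverse_mordellCurve` — the statement the proof of
Thm. 1.2 (l.523, Sylvester) applies to `x³ + y³ = p`. Via `kriz_cmRamified_of_thmM_CLAIMED` and
`rankOne_threeConverse_mordellCurve_of_cmRamified`. [claim: FanWan2023, status: under-review] -/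
theorem rankOne_threeConverse_mordellCurve_of_thmM_CLAIMED
    (h : thmM_analyticRank_eq_one_of_selmerCorank_eq_one_CLAIMED) :
    rankOne_threeConverse_mordellCurve :=
  rankOne_threeConverse_mordellCurve_of_cmRamified (kriz_cmRamified_of_thmM_CLAIMED h)

/-! ### Bookkeeping: the same from Thm. 6.9, granted the `p`-parity theorem -/

/-- `p`-parity turns Selmer corank one into root number `−1`: `(−1)^1 = w(E/ℚ)`
(Dokchitser–Dokchitser 2010, Thm. 1.4, the tree's named fact `p_parity W p`). This is the repair
of read2-fw-1 for elliptic curves over `ℚ`. [cite: DokchitserDokchitserAnnals2010, Thm. 1.4] -/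
theorem rootNumber_eq_neg_one_of_selmerCorank_eq_one (W : WeierstrassCurve ℚ) [W.IsElliptic]
    (p : ℕ) [Fact p.Prime] (hpar : p_parity W p) (h1 : W.selmerCorank p = 1) :
    W.rootNumber = -1 := by
  have h := hpar
  rw [p_parity, h1, pow_one] at h
  exact h.symm

/-- A ramified prime is not split (`CMSplit` requires `p ∤ d_K`; private plumbing). [folklore] -/
private theorem not_cmSplit_of_cmRamified (W : WeierstrassCurve ℚ) [W.IsElliptic] (p : ℕ)
    (h : CMRamified W p) : ¬ CMSplit W p :=
  fun hs ↦ hs.1 h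

/-- **Thm. 6.9 + `p`-parity ⟹ Thm. 1.1 at every NON-SPLIT prime** (for CM-by-`𝒪_K` curves over
`ℚ`): the sign hypothesis of §6 is discharged by `p_parity` (`hpar`, Dokchitser–Dokchitser 2010,
all `p`). [claim: FanWan2023, status: under-review] [cite: DokchitserDokchitserAnnals2010, Thm. 1.4] -/
theorem analyticRank_eq_one_of_not_cmSplit_of_thm69_CLAIMED_of_parity
    (h69 : thm69_analyticRank_eq_one_of_selmerCorank_eq_one_of_not_cmSplit_CLAIMED)
    (hpar : ∀ (W : WeierstrassCurve ℚ) [W.IsElliptic] (p : ℕ) [Fact p.Prime], p_parity W p)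
    (W : WeierstrassCurve ℚ) [W.IsElliptic] (hj : W.j ∈ maximalCMJInvariants) (p : ℕ)
    [Fact p.Prime] (hns : ¬ CMSplit W p) (h1 : W.selmerCorank p = 1) : W.analyticRank = 1 :=
  h69 W hj p hns (rootNumber_eq_neg_one_of_selmerCorank_eq_one W p (hpar W p) h1) h1

/-- Thm. 6.9 + `p`-parity contain Kříž's claimed Thm. 10.13 (ramified `p`).
[claim: FanWan2023, status: under-review] [cite: DokchitserDokchitserAnnals2010, Thm. 1.4] -/
theorem kriz_cmRamified_of_thm69_CLAIMED_of_parity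
    (h69 : thm69_analyticRank_eq_one_of_selmerCorank_eq_one_of_not_cmSplit_CLAIMED)
    (hpar : ∀ (W : WeierstrassCurve ℚ) [W.IsElliptic] (p : ℕ) [Fact p.Prime], p_parity W p) :
    kriz_analyticRank_eq_one_of_selmerCorank_eq_one_of_cmRamified :=
  fun W _ hj p _ hram h1 ↦
    analyticRank_eq_one_of_not_cmSplit_of_thm69_CLAIMED_of_parity h69 hpar W hj p
      (not_cmSplit_of_cmRamified W p hram) h1

/-- **The rung-S2 leaf from Thm. 6.9 + `2`-parity** (`E_n`, `p = 2` ramified in `ℚ(i)`).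
[claim: FanWan2023, status: under-review] [cite: DokchitserDokchitserAnnals2010, Thm. 1.4] -/
theorem rankOne_twoConverse_congruentNumber_of_thm69_CLAIMED_of_parity
    (h69 : thm69_analyticRank_eq_one_of_selmerCorank_eq_one_of_not_cmSplit_CLAIMED)
    (hpar : ∀ (W : WeierstrassCurve ℚ) [W.IsElliptic] (p : ℕ) [Fact p.Prime], p_parity W p) :
    rankOne_twoConverse_congruentNumber :=
  rankOne_twoConverse_congruentNumber_of_cmRamified
    (kriz_cmRamified_of_thm69_CLAIMED_of_parity h69 hpar)

/-- **The rung-S2b leaf from Thm. 6.9 + `3`-parity** (`y² = x³ + D`, `p = 3` ramified in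
`ℚ(√−3)`; for `x³ + y³ = p` the source's own route, l.523, reads the sign off [DD, Thm. 1.9]).
[claim: FanWan2023, status: under-review] [cite: DokchitserDokchitserAnnals2010, Thm. 1.4] -/
theorem rankOne_threeConverse_mordellCurve_of_thm69_CLAIMED_of_parity
    (h69 : thm69_analyticRank_eq_one_of_selmerCorank_eq_one_of_not_cmSplit_CLAIMED)
    (hpar : ∀ (W : WeierstrassCurve ℚ) [W.IsElliptic] (p : ℕ) [Fact p.Prime], p_parity W p) :
    rankOne_threeConverse_mordellCurve :=
  rankOne_threeConverse_mordellCurve_of_cmRamified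
    (kriz_cmRamified_of_thm69_CLAIMED_of_parity h69 hpar)

/-- **The printed full conclusion** ("`r_an = r_MW = 1`", as in the proof of Thm. 1.2, l.523:
"Then by the theorem of Gross–Zagier and Kolyvagin, the Mordell–Weil rank … is also one"): granted
Thm. 1.1 (`h`) and Gross–Zagier–Kolyvagin (`hGZK`, tree fact
`rank_eq_analyticRank_of_analyticRank_le_one`), a CM curve over `ℚ` with `corank_{ℤ_p} Sel_{p^∞} = 1`
has Mordell–Weil rank one and finite `Ш`. [claim: FanWan2023, status: under-review]
[cite: Darmon2004, Thm. 3.22] -/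
theorem mordellWeilRank_eq_one_of_hasCM_of_thmM_CLAIMED
    (h : thmM_analyticRank_eq_one_of_selmerCorank_eq_one_CLAIMED)
    (hGZK : rank_eq_analyticRank_of_analyticRank_le_one)
    (W : WeierstrassCurve ℚ) [W.IsElliptic] (hCM : W.HasCM) (p : ℕ) [Fact p.Prime]
    (h1 : W.selmerCorank p = 1) : W.mordellWeilRank = 1 ∧ Finite W.sha := by
  have hr : W.analyticRank = 1 := analyticRank_eq_one_of_hasCM_of_thmM_CLAIMED h W hCM p h1
  obtain ⟨hrank, hsha⟩ := hGZK W hr.le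
  exact ⟨by rw [hrank, hr], hsha⟩

/-! ### Where the claim is already a theorem in print (placement against the refereed regimes) -/

/- PLACEMENT, good ordinary regime: for a globally minimal curve with `j ∈ maximalCMJInvariants` and
`p ≥ 5` good ordinary, Thm. 1.1's conclusion `corank = 1 ⟹ r_an = 1` is Burungale–Tian's REFEREED
Theorem 1.2 — already the tree theorem
`Literature.NumberTheory.EllipticCurves.maximalOrder_form_of_burungaleTian`
(`BSDSelmerCMPConverseMaximalOrderProofs.lean`, granted the fact
`burungaleTian_analyticRank_eq_one_of_selmerCorank_eq_one_of_hasCM`); not restated here (dedup). -/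

/-- **In the GOOD SUPERSINGULAR regime `p ≥ 5`, granted `Ш[p^∞]` finite, the conclusion of
Thm. 6.9 is Burungale–Kobayashi–Ota's refereed Theorem 1.5** (`hBKO`; no sign hypothesis needed
there). Recorded to make the placement sentence of l.496 precise. [cite: BurungaleKobayashiOta2023, Thm. 1.5 (p. 1422)] -/
theorem thm69_conclusion_goodSupersingular_of_bko
    (hBKO : BurungaleKobayashiOta2024.thm15_analyticRank_eq_one_of_selmerCorank_eq_one)
    (W : WeierstrassCurve ℚ) [W.IsElliptic] [W.IsGloballyMinimal]
    (hj : W.j ∈ maximalCMJInvariants) (p : ℕ) [Fact p.Prime] (hp : 5 ≤ p)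
    (hgood : W.HasGoodReductionAtPrime p) (hss : (p : ℤ) ∣ W.frobeniusTrace p)
    (h1 : W.selmerCorank p = 1) (hsha : Finite (AddCommGroup.primaryComponent W.sha p)) :
    W.analyticRank = 1 :=
  hBKO W hj p hp hgood hss h1 hsha

end Literature.NumberTheory.EllipticCurves.FanWan2023

end
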